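import Summits.CriticalPhenomena.PercolationContinuityZ3.Theorems.Transplant.SkelPhiConcReachHabRes
import Summits.CriticalPhenomena.PercolationContinuityZ3.Theorems.Transplant.SkelPhiWinChainF2
import Summits.CriticalPhenomena.PercolationContinuityZ3.Theorems.Transplant.SkelKitResiduesHabN
import HarnessLib

/-!
# N1 (the `{±1}` node), (C) column: THE CORRIDOR RESIDUE `Skel.ReachOblAtHN G nmax` OF AN ARBITRARY ANCHORED SCHEME `S : KSchA V ℕ` FROM A
# TWO-WINDOW CHAIN — SCHEME-GENERIC form of `Skelφ.reachOblAtHN_of_schedules₂` (SkelPhiNegReachHabRes, p275798): the scheme enters only through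
# its geometry records (`LevelGeom/QSepGeom/StepsGeom/ExitGeom`) and three VERTEX-LEVEL readings (arrival cube footprints in the first core;
# step regions inside `Q_α(y) ∪ E^far_{a'}`; last core inside `M^{a'}_{y+du}`), so that the N1 scheme of record — hp-8 g33's `cellGeomSG₂` over
# the fine cell map (`EfarN₂`, weak steps; lane INBOX 2026-08-21T14:03:04Z) — or any later variant plugs in with three discharge lemmas and no re-typing
# of the chain.  Segment 1 is read through `ρ`, segment 2 through `ψ` (both 1-Lipschitz), inside the fresh habitat `Ω = E_{x,y} ∪ H_{y,y+du}`.

builds on p205010 (kernel theorem, internal audit signed; external expert review pending) — nothing in this file uses p205010; nothing here is a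
claim about the open node `SamePDropOfSkeletonNeg`.
Lane `prim-bschramm`, seat `prim-bschramm-p5` (gen 8; (C) lineage; lead ruling 13:56:39Z (i)); helper file (`--supports stmt-CriticalPhenomena-4575`).
* **`Skelφ.reachOblAtHN_of_chain₂`**.
[cite: KozmaNitzan2024, §4 Lemma 12 (pp. 23–25), p. 26 (M_x, H_{v,x}), p. 30 (Step IV), p. 31]
-/

noncomputable section

open MeasureTheory ProbabilityTheory
open scoped ENNReal Classical

namespace Summit.CriticalPhenomena.PercolationContinuityZ3.Theorems

namespace Transplant

namespace Skelφ

open Literature.Probability.Percolation Literature.Probability.LatticeModels SimpleGraph GadgetSystem ProbeHistory HSiteScheme Contour KNCells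
open KNCells.KSchA KNLevels ChainPlanar
open Skel (winGraphIn winGraphIn_le ReachOblAtHN isSubbox_Wcor_hab)

variable {V : Type} [DecidableEq V] {G : SimpleGraph V} [G.LocallyFinite] {ρ ψ : V → Site 2}

/-- **THE CORRIDOR RESIDUE OF AN ANCHORED SCHEME FROM A TWO-WINDOW CHAIN, HABITAT FORM, SCHEME-GENERIC.**  For `S : KSchA V ℕ` with face data
`FD` and level data `LD` satisfying `LevelGeom/QSepGeom/StepsGeom/ExitGeom`, a valid run history `(h, e)`, `a' ∈ anchSet`, `du` onward, the fresh
habitat `Ω = E^{α}_{x,y} ∪ H^{a'}_{y,y+du}`: two route-free frames `S₁` (read through `ρ`) and `S₂` (through `ψ`) with (i) every vertex of the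
arrival cube `M^{α}_y` has `ρ`-footprint in `S₁.core 0`, (ii) every habitat vertex whose footprint lies in a step region lies in `Q_α(y) ∪ E^far`,
(iii) the cross link, (iv) every habitat vertex whose `ψ`-footprint lies in the last core of `S₂` lies in `M^{a'}_{y+du}`; chain data, nonempty
true targets, counts, kits under the corridor law, rim excess ⟹ `Skel.ReachOblAtHN G nmax S FD Δ' δ h e a' du`.
[cite: KozmaNitzan2024, §4 Lemma 12 (pp. 23–25), p. 30 (Step IV), p. 31] -/
theorem reachOblAtHN_of_chain₂ (hlipρ : Lip G ρ) (hlipψ : Lip G ψ) {S : KSchA V ℕ} {FD : FaceData V ℕ} {LD : LevelData V ℕ}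
    (hL : LevelGeom G S.Γ FD LD) (hQ : QSepGeom G S.Γ) (hSt : StepsGeom S.Γ FD) (hEx : ExitGeom G S.Γ)
    {h : ProbeHistory V} {e : Site 2 × MDir} (hV : S.Valid₂ G h e) {a' : ℕ} (ha' : a' ∈ S.Γ.anchSet (S.aOf₁ G h e) (tgt e))
    {du : MDir} (hdu : du ∈ S.onward G h (tgt e)) {nmax : ℕ}
    (Ω : Finset V) (hΩ : Ω = S.Γ.Ewv (S.aOf₁ G h e) e.1 e.2 ∪ FD.Hfull a' (tgt e) du)
    -- segment 1 over `ρ`, segment 2 over `ψ`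
    (S₁ S₂ : SchedFrame)
    (hM0 : ∀ v ∈ S.Γ.M (S.aOf₁ G h e) (tgt e), ρ v ∈ S₁.core 0)
    (hreg₁ : ∀ k ≤ S₁.N, ∀ v ∈ Ω, ρ v ∈ S₁.region k → v ∈ S.Γ.Q (S.aOf₁ G h e) (tgt e) ∪ S.Γ.Efar a' (tgt e) du)
    (hx : WinIn ρ Ω (S₁.core (S₁.N + 1)) ⊆ WinIn ψ Ω (S₂.core 0))
    (hreg₂ : ∀ k ≤ S₂.N, ∀ v ∈ Ω, ψ v ∈ S₂.region k → v ∈ S.Γ.Q (S.aOf₁ G h e) (tgt e) ∪ S.Γ.Efar a' (tgt e) du)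
    (hlast₂ : ∀ v ∈ Ω, ψ v ∈ S₂.core (S₂.N + 1) → v ∈ S.Γ.M a' (tgt e + stepVec du))
    (hn : S₁.N + 1 + S₂.N ≤ nmax)
    -- chain data
    (P₁ P₂ : WinChainData V) (hPo₁ : P₁.o = S.Γ.root) (hPo₂ : P₂.o = S.Γ.root)
    (hPS₁ : P₁.Sfin = S.Sx G h e (S.aOf₁ G h e) a' du) (hPS₂ : P₂.Sfin = S.Sx G h e (S.aOf₁ G h e) a' du)
    (hRim₁ : ∀ k, P₁.Rim k ⊆ (planarWindowIn hlipρ Ω).stepDF S₁ k) (hRim₂ : ∀ k, P₂.Rim k ⊆ (planarWindowIn hlipψ Ω).stepDF S₂ k)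
    (hRl₁ : P₁.Rlev + 1 ≤ S₁.R') (hRl₂ : P₂.Rlev + 1 ≤ S₂.R') (hj₁ : P₁.j₁ ≤ P₁.Rlev) (hj₂ : P₂.j₁ ≤ P₂.Rlev)
    (hTne₁ : ∀ k ≤ S₁.N, ((planarWindowIn hlipρ Ω).coreTF S₁ k).Nonempty) (hTne₂ : ∀ k ≤ S₂.N, ((planarWindowIn hlipψ Ω).coreTF S₂ k).Nonempty)
    -- analytic inputs
    {Δ' : ℕ} {δ η : ℝ}
    (hcount₁ : 1 / (1 - (S.p : ℝ)) ^ (Δ' * P₁.N) ≤ δ * ((Finset.Icc P₁.j₀ P₁.j₁).card : ℝ))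
    (hcount₂ : 1 / (1 - (S.p : ℝ)) ^ (Δ' * P₂.N) ≤ δ * ((Finset.Icc P₂.j₀ P₂.j₁).card : ℝ))
    (hkits₁ : ∀ k ≤ S₁.N, ∀ j ∈ Finset.Icc P₁.j₀ P₁.j₁, ∃ (σ : SData V) (Sz : Finset V),
      SHyp (P₁.stepLF (planarWindowIn hlipρ Ω) S₁ k) j σ ∧ σ.N ≤ P₁.N ∧
      (1 - (S.p : ℝ) ^ σ.sB) ^ σ.k ≤ δ ∧ Sz ⊆ (P₁.stepLF (planarWindowIn hlipρ Ω) S₁ k).X j ∧ Sz ⊆ (planarWindowIn hlipρ Ω).stepDF S₁ k ∧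
      (∀ x ∈ σ.K, ∀ e' ∈ σ.seed x, e' ∉ wireSet (↑Sz : Set V)) ∧ (∀ x ∈ σ.K, σ.face x ⊆ Sz) ∧
      (∀ x ∈ σ.K, 1 - 3 * δ ≤ (prodBernoulli (S.Wcor G FD h e (S.aOf₁ G h e) a' du)).real {ω | ∃ u ∈ σ.face x,
        1 - δ < (prodBernoulli (pinW (S.Wcor G FD h e (S.aOf₁ G h e) a' du) (wireSet (↑Sz : Set V)) ω)).real
          (⋃ t' ∈ P₁.coreEF (planarWindowIn hlipρ Ω) S₁ k, openConnIn (↑((planarWindowIn hlipρ Ω).stepDF S₁ k) : Set V) u t')}))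
    (hkits₂ : ∀ k ≤ S₂.N, ∀ j ∈ Finset.Icc P₂.j₀ P₂.j₁, ∃ (σ : SData V) (Sz : Finset V),
      SHyp (P₂.stepLF (planarWindowIn hlipψ Ω) S₂ k) j σ ∧ σ.N ≤ P₂.N ∧
      (1 - (S.p : ℝ) ^ σ.sB) ^ σ.k ≤ δ ∧ Sz ⊆ (P₂.stepLF (planarWindowIn hlipψ Ω) S₂ k).X j ∧ Sz ⊆ (planarWindowIn hlipψ Ω).stepDF S₂ k ∧
      (∀ x ∈ σ.K, ∀ e' ∈ σ.seed x, e' ∉ wireSet (↑Sz : Set V)) ∧ (∀ x ∈ σ.K, σ.face x ⊆ Sz) ∧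
      (∀ x ∈ σ.K, 1 - 3 * δ ≤ (prodBernoulli (S.Wcor G FD h e (S.aOf₁ G h e) a' du)).real {ω | ∃ u ∈ σ.face x,
        1 - δ < (prodBernoulli (pinW (S.Wcor G FD h e (S.aOf₁ G h e) a' du) (wireSet (↑Sz : Set V)) ω)).real
          (⋃ t' ∈ P₂.coreEF (planarWindowIn hlipψ Ω) S₂ k, openConnIn (↑((planarWindowIn hlipψ Ω).stepDF S₂ k) : Set V) u t')}))
    (hη : η ≤ δ / 2)
    (hexc₁ : ∀ k ≤ S₁.N, (prodBernoulli (S.Wcor G FD h e (S.aOf₁ G h e) a' du)).real (⋃ t' ∈ P₁.Rim k, openConn S.Γ.root t') ≤ η)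
    (hexc₂ : ∀ k ≤ S₂.N, (prodBernoulli (S.Wcor G FD h e (S.aOf₁ G h e) a' du)).real (⋃ t' ∈ P₂.Rim k, openConn S.Γ.root t') ≤ η) :
    ReachOblAtHN G nmax S FD Δ' δ h e a' du := by
  subst hΩ
  set Ω := S.Γ.Ewv (S.aOf₁ G h e) e.1 e.2 ∪ FD.Hfull a' (tgt e) du with hΩdef
  set α := S.aOf₁ G h e with hαdef
  set y := tgt e with hydef
  set 𝒲₁ := planarWindowIn hlipρ Ω with h𝒲₁def
  set 𝒲₂ := planarWindowIn hlipψ Ω with h𝒲₂def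
  -- every region lies in the fresh habitat and in `Q_α(y) ∪ E^far`
  have hDΩ₁ : ∀ k, 𝒲₁.stepDF S₁ k ⊆ S.Γ.Ewv α e.1 e.2 ∪ FD.Hfull a' y du := fun k v hv => ((mem_WinIn (φ := ρ)).1 hv).1
  have hDΩ₂ : ∀ k, 𝒲₂.stepDF S₂ k ⊆ S.Γ.Ewv α e.1 e.2 ∪ FD.Hfull a' y du := fun k v hv => ((mem_WinIn (φ := ψ)).1 hv).1
  have hDh₁ : ∀ k ≤ S₁.N, 𝒲₁.stepDF S₁ k ⊆ S.Γ.Q α y ∪ S.Γ.Efar a' y du := by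
    intro k hk v hv
    obtain ⟨hvΩ, hvρ⟩ := (mem_WinIn (φ := ρ)).1 hv
    exact hreg₁ k hk v hvΩ hvρ
  have hDh₂ : ∀ k ≤ S₂.N, 𝒲₂.stepDF S₂ k ⊆ S.Γ.Q α y ∪ S.Γ.Efar a' y du := by
    intro k hk v hv
    obtain ⟨hvΩ, hvψ⟩ := (mem_WinIn (φ := ψ)).1 hv
    exact hreg₂ k hk v hvΩ hvψ
  have hSx : ∀ {v : V}, v ∈ S.Γ.Q α y ∪ S.Γ.Efar a' y du → v ∈ S.Sx G h e α a' du := by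
    intro v hv
    rcases Finset.mem_union.1 hv with hv' | hv'
    · exact Finset.mem_union_left _ (Finset.mem_union_right _ (Finset.mem_union_right _ hv'))
    · exact Finset.mem_union_right _ hv'
  -- the two-window chain
  have hC := WinChainData.chain₂ P₁ P₂ 𝒲₁ 𝒲₂ S₁ S₂ (hPo₂.trans hPo₁.symm) hRl₁ hRim₁ hTne₁ hRl₂ hRim₂ hTne₂ hx
    (fun k hk => isSubbox_Wcor_hab hL hQ hSt hV hdu ha' (hDΩ₁ k) (hDh₁ k hk)) (by rw [hPS₁]; exact finSupp_Wcor)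
    (fun k hk v hv => by rw [hPS₁]; exact hSx (hDh₁ k hk hv)) (fun k hk => by rw [hPo₁]; exact root_not_mem_of_fresh hL hQ hV hdu (hDh₁ k hk))
    (by rw [hPo₁, hPS₁]; exact Finset.mem_union_left _ (Finset.mem_union_left _ hV.root_mem)) hj₁ hcount₁ hkits₁
    (fun k hk => by rw [hPo₁]; exact hexc₁ k hk)
    (fun k hk => isSubbox_Wcor_hab hL hQ hSt hV hdu ha' (hDΩ₂ k) (hDh₂ k hk)) (by rw [hPS₂]; exact finSupp_Wcor)
    (fun k hk v hv => by rw [hPS₂]; exact hSx (hDh₂ k hk hv)) (fun k hk => by rw [hPo₂]; exact root_not_mem_of_fresh hL hQ hV hdu (hDh₂ k hk))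
    (by rw [hPo₂, hPS₂]; exact Finset.mem_union_left _ (Finset.mem_union_left _ hV.root_mem)) hj₂ hcount₂ hkits₂
    (fun k hk => by rw [hPo₁]; exact hexc₂ k hk)
  obtain ⟨ho, hlink, hsub, hkits, hexc, h0, hlast⟩ := hC
  refine ⟨S₁.N + 1 + S₂.N, hn, Ω, fun i => WinChainData.stepAF₂ P₁ P₂ 𝒲₁ 𝒲₂ S₁ S₂ i, fun i => WinChainData.coreTF₂ 𝒲₁ 𝒲₂ S₁ S₂ i, η,
    fun i => (ho i).trans hPo₁, hlink, hsub, hkits, hη, fun i => by rw [← hPo₁]; exact hexc i, ?_, ?_⟩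
  · -- the arrival cube `M_α(y) ⊆ Q_α(y) ⊆ Ω`, footprint in `core 0`
    rw [h0]
    intro v hv
    exact (mem_WinIn (φ := ρ)).2 ⟨Finset.mem_union_left _ (Finset.mem_union_right _ (hEx.M_subset_Q α y hv)), hM0 v hv⟩
  · -- the last true target enters `M^{a'}_{y+du}`
    rw [hlast]
    intro v hv
    obtain ⟨hvΩ, hvψ⟩ := (mem_WinIn (φ := ψ)).1 hv
    exact hlast₂ v hvΩ hvψ

end Skelφ

end Transplant

end Summit.CriticalPhenomena.PercolationContinuityZ3.Theorems

end
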